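import Literature.MathematicalPhysics.QuantumLattice.HubbardPairCurrentTriplet
import Literature.MathematicalPhysics.QuantumLattice.HubbardNNNHoppingTorusLimitCorrelator
import Literature.MathematicalPhysics.QuantumLattice.InfVolFermionStateParticleHole
import Literature.MathematicalPhysics.QuantumLattice.HubbardRingPerronFrobeniusProofs
import Literature.MathematicalPhysics.QuantumLattice.LocalPairOn
import Summits.HubbardSuperconductivity.HubbardSuperconductivity.Theorems.SoloInformedPseudospinPairBoundTorus
import HarnessLib

/-!
# The Mott-column selection rule in the thermodynamic limit: at half filling (`t' = 0`) the `d`-wave pair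
# two-point function of every even-torus-limit ground state IS one half of the staggered `d`-current
# (`d`-density-wave) two-point function

HONEST FRAMING: an exact IDENTITY between two two-point functions at the Mott control point `(U, n, t') = (U, 1, 0)`;
no number; it neither bounds nor signs `P_d(r)`; a dictionary/control entry — not a superconductivity verdict, no phase
sentence. Crew hubbard-obs (D-0042), seat hubbard-obs-p1 (`prover-hubbard-obs-p1-g13-0`), PAIRCORR-SDP §21.4. Zero
compute; no definition; no named fact; no `sorry`.

WHAT IS PROVED. Zhang's pseudospin triplet (`PseudospinBondPairTriplet`, `HubbardPairCurrentTriplet`: the singlet bond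
pair `d_{xy}`, its adjoint and the staggered bond current `ε_x j_{xy}` form an `η`-SU(2) triplet) and Lieb's theorem
(`HubbardHalfFilledPseudospinSinglet`: THE half-filled ground state of the even torus is an `η`-singlet) give ON EVERY
EVEN TORUS the selection rule `⟨Δ_w ψ, Δ_{w'} ψ⟩ = ½ ⟨J_w ψ, J_{w'} ψ⟩`
(`hubbardTorus_groundState_weightedPair_inner_eq_half`). This file transports it to the cell's thermodynamic-limit
row class:

* `torusStagger_ofTorusSite_proj` — on an even torus the torus stagger of `x mod L` is the lattice stagger
  `ε_x = (−1)^{x₁+x₂}` (`siteStagger`);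
* `fermionEmbed_toTorusEmb_localPairAt_dWave_eq_sum`, `fermionEmbed_toTorusEmb_localCurrent_dWave_eq_sum` — the cell's
  local `d`-wave pair `P_x^d = localPairAt ({0} ∪ unitSteps) dWaveFormFactor x` and the local `d`-CURRENT
  `J_x^d = Σ_e (g_d(e)/√2) Σ_σ (c†_{xσ} c_{x+e,σ} − c†_{x+e,σ} c_{xσ})` (written out; no definition is introduced)
  pull back into the torus as Zhang's weighted bond families over the four unit steps;
* `isGroundState_of_isGroundStateInSector_halfFilling` — on the even torus a `(L², S^z = 0)`-sector ground state is an
  `L²`-particle ground state (`E₀(L², S^z=0) = E₀(L²)`, tree `groundEnergyAt_eq_minEnergyOn_szSector`);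
* `torus_localPair_inner_eq_half_localCurrent_inner` — the selection rule in cell vocabulary on every even torus:
  `⟨Γ(P_x^d)φ, Γ(P_y^d)φ⟩ = ½ ε_x ε_y ⟨Γ(J_x^d)φ, Γ(J_y^d)φ⟩` for every sector ground state `φ`;
* **`dWavePairCorr_eq_half_stagger_currentCorr_of_isTorusLimitOf_halfFilling`** — for `U > 0` and every torus limit
  `ω` of unit `(L², S^z = 0)`-sector ground states of `hubbardTorusTT' L 1 0 U` along an EVEN side sequence
  `Ls → ∞`: **`ω.dWavePairCorr x y = ½ ε_x ε_y ω((J_x^d)⋆ J_y^d)` for all `x, y ∈ ℤ²`.**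

So at the Mott control point the `d`-wave pair correlator rows of record are not independent observables: every
certified `P_d` window there is a staggered-`d`-current (orbital-antiferromagnet) window with the factor `½` and the sign
`ε_x ε_y`, and an engine may impose the identity as EXACT rows in every `(U, 1, 0)` two-point program read along even
tori. HONEST LIMITS: half filling and `t' = 0` only (the `η`-SU(2) is broken at `n ≠ 1` or `t' ≠ 0`); even `L` only
(bipartite torus); it is silent on the size, sign or decay of either side.

## References
S.-C. Zhang, PRL 65 (1990) 120 [cite: Zhang1990]; C. N. Yang, S. C. Zhang, Mod. Phys. Lett. B 4 (1990) 759, Thm. 1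
[cite: YangZhang1990, Theorem 1]; E. H. Lieb, PRL 62 (1989) 1201, Thm. 2 [cite: LiebPRL1989, Theorem 2];
R. S. Markiewicz, M. T. Vaughn, J. Phys. Chem. Solids 59 (1998) 1737, p. 3 [cite: MarkiewiczVaughn1998, p. 3];
D. J. Scalapino, Phys. Rep. 250 (1995) 329, §2 [cite: Scalapino1995, §2]; O. Bratteli, D. W. Robinson, OAQSM 1 §4.3.1
(limits of finite-volume states) [cite: BratteliRobinsonI1987, §4.3.1]. Nearest tree prior art: the torus identity
`hubbardTorus_localPairCorr_eq_half_localCurrentCorr` (Summits/HubbardSuperconductivity/HubbardLadder, R2 rows, THE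
`L²`-particle ground state); the thermodynamic-limit / sector-ground-state form is in-house.
-/

noncomputable section

namespace Summit.Ventures.CertifiedManyBodySolver.Observables

open Matrix Finset Filter Literature.MathematicalPhysics.QuantumLattice Literature.Probability.LatticeModels
open Literature.MathematicalPhysics.QuantumLattice.HubbardWave0 ThermodynamicLimit
open scoped ComplexOrder Topology

/-! ### §1 Lattice stagger versus torus stagger on an even torus -/

/-- On an even torus the torus stagger of `x mod L` is the lattice stagger `(−1)^{x₁+x₂}` of `x`.
[cite: LiebPRL1989, proof of Theorem 2] -/
theorem torusStagger_ofTorusSite_proj {L : ℕ} [NeZero L] (hL : Even L) (x : Site 2) :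
    torusStagger (FermionTorus.ofTorusSite (Torus.proj L x)) = siteStagger x := by
  rw [torusStagger_apply]
  unfold siteStagger
  -- both sides only depend on the parity of the coordinate sums, which agree since `L` is even
  have hcoord : ∀ i : Fin 2, ((ofLex (FermionTorus.ofTorusSite (Torus.proj L x)) i : ℕ) : ℤ) = x i % (L : ℤ) := by
    intro i
    simp only [FermionTorus.ofTorusSite, ofLex_toLex, Torus.proj]
    rw [ZMod.val_intCast]
  have hsum : ((∑ i : Fin 2, (ofLex (FermionTorus.ofTorusSite (Torus.proj L x)) i : ℕ) : ℕ) : ℤ) =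
      ∑ i : Fin 2, x i % (L : ℤ) := by
    push_cast
    exact Finset.sum_congr rfl fun i _ => hcoord i
  have hpar : Even ((∑ i : Fin 2, x i) - ∑ i : Fin 2, x i % (L : ℤ)) := by
    rw [← Finset.sum_sub_distrib]
    refine Finset.even_sum _ fun i _ => ?_
    obtain ⟨k, hk⟩ := hL
    refine ⟨(k : ℤ) * (x i / (L : ℤ)), ?_⟩
    rw [Int.emod_def, sub_sub_cancel, hk]
    push_cast
    ring
  set N : ℕ := ∑ i : Fin 2, (ofLex (FermionTorus.ofTorusSite (Torus.proj L x)) i : ℕ) with hN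
  have hdecomp : (∑ i : Fin 2, x i) = (N : ℤ) + ((∑ i : Fin 2, x i) - ∑ i : Fin 2, x i % (L : ℤ)) := by
    rw [hsum]; ring
  rcases Nat.even_or_odd N with hNe | hNo
  · have h1 : ((-1 : ℤˣ) ^ N) = 1 := hNe.neg_one_pow
    rw [Int.negOnePow_even _ (by rw [hdecomp]; exact ((Int.even_coe_nat N).2 hNe).add hpar)]
    exact h1
  · have h1 : ((-1 : ℤˣ) ^ N) = -1 := hNo.neg_one_pow
    rw [Int.negOnePow_odd _ (by rw [hdecomp]; exact ((Int.odd_coe_nat N).2 hNo).add_even hpar)]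
    exact h1

/-- `(x + e) mod L = x mod L + e mod L`. [folklore] -/
private theorem proj_add'' (L : ℕ) (x e : Site 2) : Torus.proj L (x + e) = Torus.proj L x + Torus.proj L e := by
  funext i
  simp [Torus.proj]

/-- `⟨φ, Aᴴ B φ⟩ = ⟨A φ, B φ⟩`. [folklore] -/
private theorem star_dotProduct_conjTranspose_mul_mulVec {ι : Type*} [Fintype ι] [DecidableEq ι]
    (A B : Matrix ι ι ℂ) (φ : ι → ℂ) : star φ ⬝ᵥ ((Aᴴ * B) *ᵥ φ) = star (A *ᵥ φ) ⬝ᵥ (B *ᵥ φ) := by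
  rw [← mulVec_mulVec, dotProduct_mulVec, ← star_mulVec]

/-! ### §2 The local `d`-wave pair and the local `d`-current pulled back into the torus -/

/-- `0 ∉ unitSteps`. [folklore] -/
private theorem zero_not_mem_unitSteps'' : (0 : Site 2) ∉ unitSteps := by
  simp only [unitSteps, Finset.mem_insert, Finset.mem_singleton]
  decide

/-- **The local `d`-wave pair pulled back into the torus is Zhang's weighted bond-pair family over the four unit
steps** (the on-site term has weight `dWaveFormFactor 0 = 0`). [cite: Scalapino1995, §2 eq. (2.2)] -/
theorem fermionEmbed_toTorusEmb_localPairAt_dWave_eq_sum {L : ℕ} [NeZero L] (x : Site 2)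
    (h : Set.InjOn (Torus.proj (d := 2) L) ↑(pairRegion (insert (0 : Site 2) unitSteps) x)) :
    fermionEmbed (PolySite.toTorusEmb L h) (localPairAt (insert (0 : Site 2) unitSteps) dWaveFormFactor x) =
      ∑ e ∈ unitSteps, ((dWaveFormFactor e / Real.sqrt 2 : ℝ) : ℂ) •
        bondPairAnn (FermionTorus.ofTorusSite (Torus.proj L x))
          (FermionTorus.ofTorusSite (Torus.proj L x + Torus.proj L e)) := by
  rw [fermionEmbed_toTorusEmb_localPairAt, localPairOn, Finset.sum_insert zero_not_mem_unitSteps'', dWaveFormFactor_zero,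
    zero_div, Complex.ofReal_zero, zero_smul, zero_add]
  rfl

/-- **The local `d`-current pulled back into the torus is the weighted bond-current family**
`Σ_{e} (g e/√2) j_{x̄, x̄+e}` over the four unit steps. [cite: Zhang1990] [cite: MarkiewiczVaughn1998, p. 3] -/
theorem fermionEmbed_toTorusEmb_localCurrent_dWave_eq_sum {L : ℕ} [NeZero L] (x : Site 2)
    (h : Set.InjOn (Torus.proj (d := 2) L) ↑(pairRegion (insert (0 : Site 2) unitSteps) x)) :
    fermionEmbed (PolySite.toTorusEmb L h)
        (∑ e ∈ (insert (0 : Site 2) unitSteps).attach, ((dWaveFormFactor e.1 / Real.sqrt 2 : ℝ) : ℂ) •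
          ∑ σ : Fin 2, ((cAt x (self_mem_pairRegion (insert (0 : Site 2) unitSteps) x) σ)ᴴ *
              cAt (x + e.1) (add_mem_pairRegion x e.2) σ -
            (cAt (x + e.1) (add_mem_pairRegion x e.2) σ)ᴴ *
              cAt x (self_mem_pairRegion (insert (0 : Site 2) unitSteps) x) σ)) =
      ∑ e ∈ unitSteps, ((dWaveFormFactor e / Real.sqrt 2 : ℝ) : ℂ) •
        bondCurrent (FermionTorus.ofTorusSite (Torus.proj L x))
          (FermionTorus.ofTorusSite (Torus.proj L x + Torus.proj L e)) := by
  set F : Site 2 → Matrix (Finset (Orb (FermionTorus 2 L))) (Finset (Orb (FermionTorus 2 L))) ℂ := fun e =>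
    ((dWaveFormFactor e / Real.sqrt 2 : ℝ) : ℂ) •
      bondCurrent (FermionTorus.ofTorusSite (Torus.proj L x))
        (FermionTorus.ofTorusSite (Torus.proj L x + Torus.proj L e)) with hF
  rw [fermionEmbed_sum]
  have hterm : ∀ e ∈ (insert (0 : Site 2) unitSteps).attach,
      fermionEmbed (PolySite.toTorusEmb L h) (((dWaveFormFactor e.1 / Real.sqrt 2 : ℝ) : ℂ) •
          ∑ σ : Fin 2, ((cAt x (self_mem_pairRegion (insert (0 : Site 2) unitSteps) x) σ)ᴴ *
              cAt (x + e.1) (add_mem_pairRegion x e.2) σ -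
            (cAt (x + e.1) (add_mem_pairRegion x e.2) σ)ᴴ *
              cAt x (self_mem_pairRegion (insert (0 : Site 2) unitSteps) x) σ)) = F e.1 := by
    intro e _
    simp only [hF, bondCurrent, fermionEmbed_smul, fermionEmbed_sum, fermionEmbed_sub, fermionEmbed_mul,
      cAt, fermionEmbed_annihilation, fermionEmbed_creation, PolySite.toTorusEmb_apply, PolySite.ofLex_coe_pt,
      annihilation_conjTranspose, proj_add'']
  rw [Finset.sum_congr rfl hterm, Finset.sum_attach (insert (0 : Site 2) unitSteps) F,
    Finset.sum_insert zero_not_mem_unitSteps'']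
  have hF0 : F 0 = 0 := by
    rw [hF]
    simp only [dWaveFormFactor_zero, zero_div, Complex.ofReal_zero, zero_smul]
  rw [hF0, zero_add]

/-! ### §3 Sector ground states at half filling are Lieb's ground state; the finite-torus selection rule -/

/-- **On the even torus the `(N = L², S^z = 0)`-sector ground states are the `L²`-particle ground states**
(`E₀(L², S^z = 0) = E₀(L²)` by `SU(2)`). [cite: LiebPRL1989, Theorem 2] -/
theorem isGroundState_of_isGroundStateInSector_halfFilling {L : ℕ} [NeZero L] (hL : Even L) (t U : ℝ)
    {φ : Fock (Orb (FermionTorus 2 L))} (hφ : IsGroundStateInSector (hubbardTorus 2 L t U) (L ^ 2) 0 φ) :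
    IsGroundState (hamiltonian (fermionTorusGraph 2 L) t U) (L ^ 2) φ := by
  have hN : IsNParticle (L ^ 2) φ := ((mem_szSector_iff _ _ φ).1 hφ.1).1
  have hev : Even (L ^ 2) := Nat.even_pow.2 ⟨hL, two_ne_zero⟩
  have hcard : L ^ 2 / 2 ≤ Fintype.card (FermionTorus 2 L) := by
    rw [show Fintype.card (FermionTorus 2 L) = L ^ 2 by
      simp only [FermionTorus, Fintype.card_lex, Fintype.card_fun, Fintype.card_fin]]
    exact Nat.div_le_self _ _
  have hE := groundEnergyAt_eq_minEnergyOn_szSector (G := fermionTorusGraph 2 L) t U hcard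
  rw [Nat.two_mul_div_two_of_even hev] at hE
  refine ⟨hN, hφ.2.1, ?_⟩
  have h3 := hφ.2.2
  rw [hubbardTorus] at h3
  rw [h3, ← hE]
  rfl

/-- **THE SELECTION RULE ON THE EVEN TORUS, cell vocabulary.** For a `(L², S^z = 0)`-sector ground state `φ` of the
half-filled `t`-`U` torus (`L` even, `t ≠ 0`, `U > 0`) and sites `x, y ∈ ℤ²` whose pair regions fit into the torus:
`⟨Γ(P_x^d)φ, Γ(P_y^d)φ⟩ = ½ ε_x ε_y ⟨Γ(J_x^d)φ, Γ(J_y^d)φ⟩` (`Γ` the pull-back into the torus; `J^d` the local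
`d`-current; `ε` the lattice stagger). [cite: Zhang1990] [cite: LiebPRL1989, Theorem 2] -/
theorem torus_localPair_inner_eq_half_localCurrent_inner {L : ℕ} [NeZero L] (hL : Even L) {t U : ℝ} (ht : t ≠ 0)
    (hU : 0 < U) {φ : Fock (Orb (FermionTorus 2 L))} (hφ : IsGroundStateInSector (hubbardTorus 2 L t U) (L ^ 2) 0 φ)
    (x y : Site 2) (hx : Set.InjOn (Torus.proj (d := 2) L) ↑(pairRegion (insert (0 : Site 2) unitSteps) x))
    (hy : Set.InjOn (Torus.proj (d := 2) L) ↑(pairRegion (insert (0 : Site 2) unitSteps) y)) :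
    star (fermionEmbed (PolySite.toTorusEmb L hx) (localPairAt (insert (0 : Site 2) unitSteps) dWaveFormFactor x) *ᵥ φ) ⬝ᵥ
        (fermionEmbed (PolySite.toTorusEmb L hy) (localPairAt (insert (0 : Site 2) unitSteps) dWaveFormFactor y) *ᵥ φ) =
      (1 / 2 : ℂ) * (((siteStagger x : ℤ) : ℂ) * ((siteStagger y : ℤ) : ℂ)) *
        (star (fermionEmbed (PolySite.toTorusEmb L hx)
            (∑ e ∈ (insert (0 : Site 2) unitSteps).attach, ((dWaveFormFactor e.1 / Real.sqrt 2 : ℝ) : ℂ) •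
          ∑ σ : Fin 2, ((cAt x (self_mem_pairRegion (insert (0 : Site 2) unitSteps) x) σ)ᴴ *
              cAt (x + e.1) (add_mem_pairRegion x e.2) σ -
            (cAt (x + e.1) (add_mem_pairRegion x e.2) σ)ᴴ *
              cAt x (self_mem_pairRegion (insert (0 : Site 2) unitSteps) x) σ)) *ᵥ φ) ⬝ᵥ
          (fermionEmbed (PolySite.toTorusEmb L hy)
            (∑ e ∈ (insert (0 : Site 2) unitSteps).attach, ((dWaveFormFactor e.1 / Real.sqrt 2 : ℝ) : ℂ) •
          ∑ σ : Fin 2, ((cAt y (self_mem_pairRegion (insert (0 : Site 2) unitSteps) y) σ)ᴴ *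
              cAt (y + e.1) (add_mem_pairRegion y e.2) σ -
            (cAt (y + e.1) (add_mem_pairRegion y e.2) σ)ᴴ *
              cAt y (self_mem_pairRegion (insert (0 : Site 2) unitSteps) y) σ)) *ᵥ φ)) := by
  have hgs := isGroundState_of_isGroundStateInSector_halfFilling hL t U hφ
  rw [fermionEmbed_toTorusEmb_localPairAt_dWave_eq_sum x hx, fermionEmbed_toTorusEmb_localPairAt_dWave_eq_sum y hy,
    fermionEmbed_toTorusEmb_localCurrent_dWave_eq_sum x hx, fermionEmbed_toTorusEmb_localCurrent_dWave_eq_sum y hy]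
  set X := Torus.proj L x with hX
  set Y := Torus.proj L y with hY
  have hεx : ∀ e ∈ unitSteps, torusStagger (FermionTorus.ofTorusSite (X + Torus.proj L e)) =
      -torusStagger (FermionTorus.ofTorusSite X) := fun e he =>
    Summit.HubbardSuperconductivity.HubbardSuperconductivity.Theorems.torusStagger_ofTorusSite_add hL X he
  have hεy : ∀ e ∈ unitSteps, torusStagger (FermionTorus.ofTorusSite (Y + Torus.proj L e)) =
      -torusStagger (FermionTorus.ofTorusSite Y) := fun e he =>
    Summit.HubbardSuperconductivity.HubbardSuperconductivity.Theorems.torusStagger_ofTorusSite_add hL Y he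
  have key := hubbardTorus_groundState_weightedPair_inner_eq_half hL ht hU hgs unitSteps
    (fun e => (FermionTorus.ofTorusSite X, FermionTorus.ofTorusSite (X + Torus.proj L e)))
    (fun e => ((dWaveFormFactor e / Real.sqrt 2 : ℝ) : ℂ)) hεx unitSteps
    (fun e => (FermionTorus.ofTorusSite Y, FermionTorus.ofTorusSite (Y + Torus.proj L e)))
    (fun e => ((dWaveFormFactor e / Real.sqrt 2 : ℝ) : ℂ)) hεy
  rw [key]
  -- pull the (constant) staggers out of the current sums
  have hfac : ∀ (Z : TorusSite 2 L),
      (∑ e ∈ unitSteps, ((((dWaveFormFactor e / Real.sqrt 2 : ℝ) : ℂ)) *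
          ((torusStagger (FermionTorus.ofTorusSite Z) : ℤ) : ℂ)) •
        bondCurrent (FermionTorus.ofTorusSite Z) (FermionTorus.ofTorusSite (Z + Torus.proj L e))) =
      ((torusStagger (FermionTorus.ofTorusSite Z) : ℤ) : ℂ) •
        ∑ e ∈ unitSteps, ((dWaveFormFactor e / Real.sqrt 2 : ℝ) : ℂ) •
          bondCurrent (FermionTorus.ofTorusSite Z) (FermionTorus.ofTorusSite (Z + Torus.proj L e)) := by
    intro Z
    rw [Finset.smul_sum]
    refine Finset.sum_congr rfl fun e _ => ?_
    rw [smul_smul, mul_comm]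
  rw [hfac X, hfac Y, smul_mulVec, smul_mulVec, star_smul, smul_dotProduct, dotProduct_smul,
    torusStagger_ofTorusSite_proj hL x, torusStagger_ofTorusSite_proj hL y, smul_eq_mul, smul_eq_mul]
  have hreal : ∀ u : ℤˣ, star (((u : ℤ) : ℂ)) = ((u : ℤ) : ℂ) := fun u => by
    rw [Complex.star_def, ← Complex.ofReal_intCast, Complex.conj_ofReal]
  rw [hreal]
  ring

/-! ### §4 The thermodynamic limit: every even-torus-limit ground state at half filling -/

variable {U : ℝ} {ω : InfVolFermionState 2}

/-- **THE MOTT-COLUMN SELECTION RULE IN THE THERMODYNAMIC LIMIT** (`t = 1`, `t' = 0`, `n = 1`, every `U > 0`). Let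
`ψ_L` be `(L², S^z = 0)`-sector ground states of `hubbardTorusTT' L 1 0 U`, unit along an EVEN side sequence
`Ls → ∞`, and `ω` a torus limit of their translation averages (the cell's row class at the Mott control point, read
along even tori). Then for all `x, y ∈ ℤ²` the cell's `d`-wave pair two-point function IS one half of the staggered
`d`-current (`d`-density-wave / orbital-antiferromagnet) two-point function:
`ω(P_x^{d⋆} P_y^d) = ½ ε_x ε_y ω(J_x^{d⋆} J_y^d)`, `J_x^d = Σ_e (g_d(e)/√2) Σ_σ (c†_{xσ}c_{x+e,σ} − c†_{x+e,σ}c_{xσ})`.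
At the Mott control point the `d`-wave pair correlator rows of record are NOT independent observables: every certified
`P_d` cell there is a `d`-current cell and conversely (factor `½`, sign `ε_x ε_y`). An exact IDENTITY; no number; half
filling and `t' = 0` only. [cite: Zhang1990] [cite: LiebPRL1989, Theorem 2] [cite: MarkiewiczVaughn1998, p. 3] -/
theorem dWavePairCorr_eq_half_stagger_currentCorr_of_isTorusLimitOf_halfFilling (hU : 0 < U) {Ls : ℕ → ℕ}
    (hLs : Tendsto Ls atTop atTop) (hev : ∀ j, Even (Ls j)) {ψ : ∀ L, Fock (Orb (FermionTorus 2 L))}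
    (hψ : ∀ L, IsGroundStateInSector (hubbardTorusTT' L 1 0 U) (L ^ 2) 0 (ψ L))
    (hω : ω.IsTorusLimitOf ψ Ls) (x y : Site 2) :
    ω.dWavePairCorr x y =
      (1 / 2 : ℂ) * (((siteStagger x : ℤ) : ℂ) * ((siteStagger y : ℤ) : ℂ)) *
        ω.corr
          ((∑ e ∈ (insert (0 : Site 2) unitSteps).attach, ((dWaveFormFactor e.1 / Real.sqrt 2 : ℝ) : ℂ) •
          ∑ σ : Fin 2, ((cAt x (self_mem_pairRegion (insert (0 : Site 2) unitSteps) x) σ)ᴴ *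
              cAt (x + e.1) (add_mem_pairRegion x e.2) σ -
            (cAt (x + e.1) (add_mem_pairRegion x e.2) σ)ᴴ *
              cAt x (self_mem_pairRegion (insert (0 : Site 2) unitSteps) x) σ)))ᴴ
          (∑ e ∈ (insert (0 : Site 2) unitSteps).attach, ((dWaveFormFactor e.1 / Real.sqrt 2 : ℝ) : ℂ) •
          ∑ σ : Fin 2, ((cAt y (self_mem_pairRegion (insert (0 : Site 2) unitSteps) y) σ)ᴴ *
              cAt (y + e.1) (add_mem_pairRegion y e.2) σ -
            (cAt (y + e.1) (add_mem_pairRegion y e.2) σ)ᴴ *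
              cAt y (self_mem_pairRegion (insert (0 : Site 2) unitSteps) y) σ)) := by
  -- the test observable in the union region
  set Rx := pairRegion (insert (0 : Site 2) unitSteps) x with hRx
  set Ry := pairRegion (insert (0 : Site 2) unitSteps) y with hRy
  set Px : FermionOp Rx := localPairAt (insert (0 : Site 2) unitSteps) dWaveFormFactor x with hPx
  set Py : FermionOp Ry := localPairAt (insert (0 : Site 2) unitSteps) dWaveFormFactor y with hPy
  set Jx : FermionOp Rx :=
    (∑ e ∈ (insert (0 : Site 2) unitSteps).attach, ((dWaveFormFactor e.1 / Real.sqrt 2 : ℝ) : ℂ) •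
          ∑ σ : Fin 2, ((cAt x (self_mem_pairRegion (insert (0 : Site 2) unitSteps) x) σ)ᴴ *
              cAt (x + e.1) (add_mem_pairRegion x e.2) σ -
            (cAt (x + e.1) (add_mem_pairRegion x e.2) σ)ᴴ *
              cAt x (self_mem_pairRegion (insert (0 : Site 2) unitSteps) x) σ)) with hJx
  set Jy : FermionOp Ry :=
    (∑ e ∈ (insert (0 : Site 2) unitSteps).attach, ((dWaveFormFactor e.1 / Real.sqrt 2 : ℝ) : ℂ) •
          ∑ σ : Fin 2, ((cAt y (self_mem_pairRegion (insert (0 : Site 2) unitSteps) y) σ)ᴴ *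
              cAt (y + e.1) (add_mem_pairRegion y e.2) σ -
            (cAt (y + e.1) (add_mem_pairRegion y e.2) σ)ᴴ *
              cAt y (self_mem_pairRegion (insert (0 : Site 2) unitSteps) y) σ)) with hJy
  set c : ℂ := (1 / 2 : ℂ) * (((siteStagger x : ℤ) : ℂ) * ((siteStagger y : ℤ) : ℂ)) with hc
  set Xobs : FermionOp (Rx ∪ Ry) :=
    fermionEmbed (PolySite.incl Finset.subset_union_left) Pxᴴ * fermionEmbed (PolySite.incl Finset.subset_union_right) Py -
      c • (fermionEmbed (PolySite.incl Finset.subset_union_left) Jxᴴ *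
        fermionEmbed (PolySite.incl Finset.subset_union_right) Jy) with hXobs
  -- its expectation is the difference of the two sides
  have hexp : ω.expect (Rx ∪ Ry) Xobs = ω.dWavePairCorr x y - c * ω.corr Jxᴴ Jy := by
    rw [hXobs, map_sub, map_smul, smul_eq_mul, InfVolFermionState.dWavePairCorr, InfVolFermionState.pairCorr,
      InfVolFermionState.corr_eq, InfVolFermionState.corr_eq, fermionEmbed_conjTranspose, fermionEmbed_conjTranspose]
  -- the torus averages of `Xobs` vanish for all large `j`
  obtain ⟨L₀, hL₀⟩ := exists_forall_le_injOn_proj (Rx ∪ Ry)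
  have hzero : ∀ᶠ j in atTop, torusAvgExpect (Ls j) (Rx ∪ Ry) Xobs (ψ (Ls j)) = 0 := by
    filter_upwards [hLs.eventually_ge_atTop (L₀ + 1)] with j hj
    haveI : NeZero (Ls j) := ⟨by omega⟩
    have hInj := hL₀ (Ls j) (by omega)
    have hx : Set.InjOn (Torus.proj (d := 2) (Ls j)) ↑Rx := hInj.mono (Finset.coe_subset.2 Finset.subset_union_left)
    have hy : Set.InjOn (Torus.proj (d := 2) (Ls j)) ↑Ry := hInj.mono (Finset.coe_subset.2 Finset.subset_union_right)
    rw [torusAvgExpect_eq, torusAvgExpectAt_of_injOn (Ls j) hInj]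
    have hObs : fermionEmbed (PolySite.toTorusEmb (Ls j) hInj) Xobs =
        (fermionEmbed (PolySite.toTorusEmb (Ls j) hx) Px)ᴴ * fermionEmbed (PolySite.toTorusEmb (Ls j) hy) Py -
          c • ((fermionEmbed (PolySite.toTorusEmb (Ls j) hx) Jx)ᴴ * fermionEmbed (PolySite.toTorusEmb (Ls j) hy) Jy) := by
      rw [hXobs, fermionEmbed_sub, fermionEmbed_smul, fermionEmbed_mul, fermionEmbed_mul, fermionEmbed_fermionEmbed,
        fermionEmbed_fermionEmbed, fermionEmbed_fermionEmbed, fermionEmbed_fermionEmbed,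
        fermionEmbed_congr (φ := (PolySite.incl Finset.subset_union_left).trans (PolySite.toTorusEmb (Ls j) hInj))
          (ψ := PolySite.toTorusEmb (Ls j) hx) (fun _ => rfl),
        fermionEmbed_congr (φ := (PolySite.incl Finset.subset_union_right).trans (PolySite.toTorusEmb (Ls j) hInj))
          (ψ := PolySite.toTorusEmb (Ls j) hy) (fun _ => rfl),
        fermionEmbed_conjTranspose, fermionEmbed_conjTranspose]
    rw [hObs]
    have hterm : ∀ v : TorusSite 2 (Ls j),
        expect ((fermionEmbed (PolySite.toTorusEmb (Ls j) hx) Px)ᴴ * fermionEmbed (PolySite.toTorusEmb (Ls j) hy) Py -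
          c • ((fermionEmbed (PolySite.toTorusEmb (Ls j) hx) Jx)ᴴ * fermionEmbed (PolySite.toTorusEmb (Ls j) hy) Jy))
          ((fockTranslate v).val *ᵥ ψ (Ls j)) = 0 := by
      intro v
      have hφ : IsGroundStateInSector (hubbardTorus 2 (Ls j) 1 U) ((Ls j) ^ 2) 0 ((fockTranslate v).val *ᵥ ψ (Ls j)) := by
        have h0 := hψ (Ls j)
        rw [hubbardTorusTT'_zero] at h0
        exact h0.fockTranslate_mulVec v (relabel_translate_hubbardTorus v 1 U)
      have hid := torus_localPair_inner_eq_half_localCurrent_inner (hev j) one_ne_zero hU hφ x y hx hy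
      rw [Literature.MathematicalPhysics.QuantumLattice.expect, sub_mulVec, dotProduct_sub, smul_mulVec, dotProduct_smul,
        star_dotProduct_conjTranspose_mul_mulVec, star_dotProduct_conjTranspose_mul_mulVec, smul_eq_mul, hPx, hPy, hJx,
        hJy, hid, hc]
      ring
    simp only [hterm, Finset.sum_const_zero, mul_zero]
  -- conclude by uniqueness of limits
  have hlim := hω (Rx ∪ Ry) Xobs
  have h0 : ω.expect (Rx ∪ Ry) Xobs = 0 :=
    tendsto_nhds_unique hlim (tendsto_const_nhds.congr' (hzero.mono fun j hj => hj.symm))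
  rw [hexp, sub_eq_zero] at h0
  rw [h0]

end Summit.Ventures.CertifiedManyBodySolver.Observables

end
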